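import Mathlib

/-!
# AtomicCalibrationR (stmt-QuantumFields-28169), E2 `stub_offDiagonalWhitney` — counting grid cubes near the coincidence locus
# (Plan A step 6 `card_assigned_le` of planner ym-idea-11 g15's `STUB-PLAN-offDiagonalWhitney.md`, discrete core; prover w4 g22)

The combinatorial heart of the Schwartz bookkeeping: the number of integer multi-indices `c : Fin n × Fin 4 → ℤ` in the box
`|c_q| ≤ R` having a **near pair** of slots (`∃ l ≠ l', ∀ i, |c_{l,i} − c_{l',i}| ≤ T`) is at most
`n² (2T+1)⁴ (2R+1)^{4n−4}` — the tube around the codimension-`4` coincidence planes costs four factors of `R`.  (A grid cube of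
mesh `h` assigned to the dyadic band `dist ≍ 2^{−k}` inside `‖z‖ ≤ r` has such an index with `R ≍ r/h`, `T ≍ 2^{−k}/h ≍ Λ`;
this gives the plan's `(cΛn)^{O(1)} (2^k r)^{4n−4}` count.)

* `nearPairBox n R T`, `card_slotNearBox_le` (one fixed ordered pair: `≤ (2T+1)⁴ (2R+1)^{4n−4}` by an explicit injection),
  `card_nearPairBox_le`.

Mathlib only; no stub/crux/rung/summit is closed; nothing here touches Yang–Mills; the YM mass gap is NOT proved. [folklore]
-/

set_option autoImplicit false

noncomputable section

open scoped BigOperators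

namespace Summit.QuantumFields.YangMills.Cruxes.AtomicCalibrationR.BandCount

/-- The integer box `{c | ∀ q, |c_q| ≤ R}`. -/
def intBox (n R : ℕ) : Finset (Fin n × Fin 4 → ℤ) :=
  Fintype.piFinset fun _ => Finset.Icc (-(R : ℤ)) R

/-- Multi-indices in the box whose slots `l, l'` (a fixed ordered pair) are `T`-close in every coordinate. -/
def slotNearBox (n R T : ℕ) (l l' : Fin n) : Finset (Fin n × Fin 4 → ℤ) :=
  (intBox n R).filter fun c => ∀ i : Fin 4, |c (l, i) - c (l', i)| ≤ T

/-- Multi-indices in the box with SOME near pair of distinct slots. -/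
def nearPairBox (n R T : ℕ) : Finset (Fin n × Fin 4 → ℤ) :=
  (intBox n R).filter fun c => ∃ l l' : Fin n, l ≠ l' ∧ ∀ i : Fin 4, |c (l, i) - c (l', i)| ≤ T

/-- The number of coordinates `q = (l, i)` in a fixed slot `l` is `4`. -/
theorem card_filter_fst_eq (n : ℕ) (l : Fin n) :
    (Finset.univ.filter fun q : Fin n × Fin 4 => q.1 = l).card = 4 := by
  have : (Finset.univ.filter fun q : Fin n × Fin 4 => q.1 = l) = ({l} : Finset (Fin n)) ×ˢ (Finset.univ : Finset (Fin 4)) := by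
    ext q
    simp only [Finset.mem_filter, Finset.mem_univ, true_and, Finset.mem_product, Finset.mem_singleton, and_true]
  rw [this, Finset.card_product, Finset.card_singleton, Finset.card_univ, Fintype.card_fin]

/-- The number of coordinates outside a fixed slot is `4n − 4`. -/
theorem card_filter_fst_ne (n : ℕ) (l : Fin n) :
    (Finset.univ.filter fun q : Fin n × Fin 4 => ¬ q.1 = l).card = 4 * n - 4 := by
  have h := Finset.card_filter_add_card_filter_not (s := (Finset.univ : Finset (Fin n × Fin 4))) (fun q => q.1 = l)
  rw [card_filter_fst_eq, Finset.card_univ, Fintype.card_prod, Fintype.card_fin, Fintype.card_fin] at h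
  omega

/-- **One ordered pair.**  `#slotNearBox ≤ (2T+1)⁴ (2R+1)^{4n−4}`: the map replacing the slot-`l` coordinates by their
differences to slot `l'` is injective on `slotNearBox` and lands in a box with four short sides. -/
theorem card_slotNearBox_le (n R T : ℕ) {l l' : Fin n} (hll' : l ≠ l') :
    (slotNearBox n R T l l').card ≤ (2 * T + 1) ^ 4 * (2 * R + 1) ^ (4 * n - 4) := by
  classical
  -- target box: short sides in slot `l`, long sides elsewhere
  let t : Fin n × Fin 4 → Finset ℤ := fun q => if q.1 = l then Finset.Icc (-(T : ℤ)) T else Finset.Icc (-(R : ℤ)) R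
  let g : (Fin n × Fin 4 → ℤ) → (Fin n × Fin 4 → ℤ) := fun c q => if q.1 = l then c (l, q.2) - c (l', q.2) else c q
  have hcardT : (Fintype.piFinset t).card = (2 * T + 1) ^ 4 * (2 * R + 1) ^ (4 * n - 4) := by
    -- `#{-m,…,m} = 2m+1` (the tree's `Literature.Analysis.FunctionSpaces.Torus.card_Icc_neg_self`, inlined)
    have hIcc : ∀ m : ℕ, (Finset.Icc (-(m : ℤ)) m).card = 2 * m + 1 := fun m => by
      rw [Int.card_Icc]; omega
    rw [Fintype.card_piFinset]
    have : ∀ q : Fin n × Fin 4, (t q).card = if q.1 = l then 2 * T + 1 else 2 * R + 1 := by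
      intro q
      by_cases hq : q.1 = l
      · simp only [t, hq, if_true, hIcc]
      · simp only [t, hq, if_false, hIcc]
    simp_rw [this]
    rw [Finset.prod_ite, Finset.prod_const, Finset.prod_const, card_filter_fst_eq, card_filter_fst_ne]
  rw [← hcardT]
  refine Finset.card_le_card_of_injOn g (fun c hc => ?_) (fun c hc c' hc' hcc' => ?_)
  · -- maps into the target box
    rw [Finset.mem_coe, slotNearBox, Finset.mem_filter, intBox, Fintype.mem_piFinset] at hc
    rw [Finset.mem_coe, Fintype.mem_piFinset]
    intro q
    by_cases hq : q.1 = l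
    · simp only [g, t, hq, if_true, Finset.mem_Icc]
      exact abs_le.1 (hc.2 q.2)
    · simp only [g, t, hq, if_false]
      exact hc.1 q
  · -- injective on `slotNearBox`
    rw [Finset.mem_coe, slotNearBox, Finset.mem_filter] at hc hc'
    funext q
    have hoff : ∀ q : Fin n × Fin 4, ¬ q.1 = l → c q = c' q := by
      intro q hq
      have := congrFun hcc' q
      simpa only [g, hq, if_false] using this
    by_cases hq : q.1 = l
    · have hdiff := congrFun hcc' (l, q.2)
      simp only [g, if_true] at hdiff
      have hl' : c (l', q.2) = c' (l', q.2) := hoff (l', q.2) (fun h => hll' h.symm)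
      have hql : q = (l, q.2) := Prod.ext hq rfl
      rw [hql]
      linarith
    · exact hoff q hq

/-- **Counting cubes near the coincidence locus.**  `#nearPairBox n R T ≤ n² (2T+1)⁴ (2R+1)^{4n−4}`. [folklore] -/
theorem card_nearPairBox_le (n R T : ℕ) :
    (nearPairBox n R T).card ≤ n ^ 2 * ((2 * T + 1) ^ 4 * (2 * R + 1) ^ (4 * n - 4)) := by
  classical
  have hsub : nearPairBox n R T ⊆
      ((Finset.univ : Finset (Fin n × Fin n)).filter fun p => p.1 ≠ p.2).biUnion
        fun p => slotNearBox n R T p.1 p.2 := by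
    intro c hc
    rw [nearPairBox, Finset.mem_filter] at hc
    obtain ⟨hbox, l, l', hll', hnear⟩ := hc
    rw [Finset.mem_biUnion]
    exact ⟨(l, l'), Finset.mem_filter.2 ⟨Finset.mem_univ _, hll'⟩, Finset.mem_filter.2 ⟨hbox, hnear⟩⟩
  refine (Finset.card_le_card hsub).trans ?_
  refine (Finset.card_biUnion_le_card_mul _ _ ((2 * T + 1) ^ 4 * (2 * R + 1) ^ (4 * n - 4))
    fun p hp => card_slotNearBox_le n R T (Finset.mem_filter.1 hp).2).trans ?_
  refine Nat.mul_le_mul_right _ ?_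
  calc ((Finset.univ : Finset (Fin n × Fin n)).filter fun p => p.1 ≠ p.2).card
      ≤ (Finset.univ : Finset (Fin n × Fin n)).card := Finset.card_filter_le _ _
    _ = n ^ 2 := by rw [Finset.card_univ, Fintype.card_prod, Fintype.card_fin, sq]

end Summit.QuantumFields.YangMills.Cruxes.AtomicCalibrationR.BandCount

end
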